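import Literature.NumberTheory.Automorphic.WhittakerSupportFinite
import Literature.NumberTheory.Automorphic.GLnAdelicStructure
import Mathlib.RingTheory.DiscreteValuationRing.Basic
import HarnessLib

/-!
# The subgroups of `GL₂(𝒪)` containing a `Γ₀(ϖ^a)`-level subgroup are exactly the `Γ₀(ϖ^c)`, `c ≤ a`
# (kernel form of the group-theoretic half of "`U₀(𝔫₀)` is a minimal level"; PROVED, no named fact)

Context (cell `pub/bsd-litref/bcs25`, row D1 of the rank-`≤ 1` partition). The D-audit of
`Literature.NumberTheory.EllipticCurves.BurungaleCastellaSkinner2025.cor131_padicValRat_bsd_rank_le_one`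
locates the unpublished input [Fuj06] of [Wan15, Thm. 3] and, for the CLEAN sub-population, a
refereed replacement through Manning, *Algebra & Number Theory* 15 (2021) 387–434 (minimal-level
multiplicity one ⇒ freeness), modulo glue (G1): "`U₀(𝔫₀) · ∏_{v ∤ 𝔫₀} GL₂(𝒪_v)` is a minimal level of
`ρ̄` in Manning's sense" (reader-1 sheet `pub/bsd-litref/bcs25/sheets/D-AUDIT-bcs25-r1.md`
c5b8643a52e7214b §C.2 and ADDENDUM-1 dbc9aa2f3ef990bc §A).  Manning's levels are PRODUCT-form compact
open subgroups `K = ∏_v K_v ⊆ ∏_v GL₂(𝒪_v)` and "a minimal level of `ρ̄` is an element of `𝒦^D(ρ̄)`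
which is maximal under inclusion" (§1); the sheet reduces (G1) to Casselman's conductor theorem
(Gelbart 1975, Thm. 4.24; Carayol; Livné) plus the following ELEMENTARY LEMMA (L2), proved there by
hand and here in the kernel:

> (L2) Let `𝒪` be a discrete valuation ring with uniformiser `ϖ`, `a ≥ 1`,
> `U := U₀(v^a) = {g ∈ GL₂(𝒪) : g₁₀ ∈ ϖ^a 𝒪}`. Every subgroup `H` with `U ⊆ H ⊆ GL₂(𝒪)` equals
> `U₀(v^c)` for some `0 ≤ c ≤ a`.

This file is SUPPORT for that audit (referee-C/C4 object), not a census door: nothing here bears on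
`BSDp`; it types-and-proves one glue step so that the desk can price (G1) as "subgroup lemma = tree
theorem + three printed facts".  HONEST FRAMING: bookkeeping for a D-audit; BSD is not advanced by it.

Setting and results. `R` is a commutative LOCAL ring whose maximal ideal is principal, `𝔪 = (ϖ)`
(this covers `𝒪_v` and every DVR — `exists_eq_gammaZeroGL_span_pow_of_irreducible` — with no
hypothesis on the residue field), `gammaZeroGL I = Γ₀(I) = {g ∈ GL₂(R) | g₁₀ ∈ I}` (one definition;
the `SL₂` sibling is `Literature.NumberTheory.Automorphic.Gamma0` of `BianchiMaassCuspForms`).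

* `exists_eq_gammaZeroGL_span_pow` (**(L2), the lattice of intermediate subgroups**): every subgroup
  `H ≤ GL₂(R)` with `Γ₀(ϖ^a) ≤ H` is `Γ₀(ϖ^c)` for some `c ≤ a`; `exists_gammaZeroGL_span_pow_le_of_lt`
  (**maximality form**): a subgroup STRICTLY containing `Γ₀(ϖ^a)` contains some `Γ₀(ϖ^c)`, `c < a`;
  `gammaZeroGL_span_pow_ne_top`: `Γ₀(ϖ^a) ≠ GL₂(R)` for `a ≥ 1`.
* Proof (the sheet's, step by step): `c :=` the largest `k ≤ a` with `h₁₀ ∈ (ϖ^k)` for all `h ∈ H`,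
  so `H ≤ Γ₀(ϖ^c)`; if `c < a` pick `h ∈ H` with `h₁₀ = t ϖ^c`, `t` a unit; replacing `h` by `n⁺(1) h`
  if necessary `h₀₀` is a unit, and `h = n⁻(h₁₀/h₀₀) b` with `b` upper triangular, so `n⁻(u ϖ^c) ∈ H`
  for a unit `u`, hence (conjugating by diagonal units) for every unit; every `y ∈ (ϖ^c)` is `s ϖ^c`
  with `s` or `1 + s` a unit, so `n⁻(y) ∈ H` (`n⁻` is additive); finally every `g ∈ Γ₀(ϖ^c)`
  factors as `n⁻(g₁₀/g₀₀) b` (after the same `n⁺(1)` trick when `g₀₀` is not a unit), so `g ∈ H`.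
  Elementary matrices are the tree's `Literature.NumberTheory.Automorphic.transvectionUnit`
  (`WhittakerSupportFinite`) and `Literature.NumberTheory.Automorphic.glDiagonal` (`GLnAdelicStructure`).

References (context only; the lemma itself is folklore and is PROVED here): J. Manning, *Patching
and multiplicity `2^k` for Shimura curves*, ANT 15 (2021) 387–434, §1; S. Gelbart, *Automorphic forms
on adele groups*, Ann. of Math. Studies 83 (1975), Thm. 4.24 (Casselman's conductor theorem).
-/

namespace Summit.BirchSwinnertonDyer.Rank1Residual.BCS25

open Matrix Literature.NumberTheory.Automorphic

variable {R : Type*} [CommRing R]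

/-! ### The level subgroup `Γ₀(I) ≤ GL₂(R)` -/

section GammaZero

/-- **The `Γ₀(I)`-type level subgroup of `GL₂(R)`** for an ideal `I` of a commutative ring `R`: the
invertible `2 × 2` matrices whose lower-left entry lies in `I` (for `R = 𝒪_v`, `I = (ϖ_v^a)` this is
the local Hecke/Eichler level group `U₀(v^a) = K₀(ϖ^a)`; for `I = ⊥` it is the upper triangular Borel
subgroup `B(R)`, for `I = ⊤` all of `GL₂(R)`).  The `SL₂` version is
`Literature.NumberTheory.Automorphic.Gamma0` (`BianchiMaassCuspForms`). [folklore] -/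
def gammaZeroGL (I : Ideal R) : Subgroup (GL (Fin 2) R) where
  carrier := {g | (g : Matrix (Fin 2) (Fin 2) R) 1 0 ∈ I}
  mul_mem' {g h} hg hh := by
    change ((g * h : GL (Fin 2) R) : Matrix (Fin 2) (Fin 2) R) 1 0 ∈ I
    rw [Units.val_mul, Matrix.mul_apply, Fin.sum_univ_two]
    exact I.add_mem (I.mul_mem_right _ hg) (I.mul_mem_left _ hh)
  one_mem' := by
    change ((1 : GL (Fin 2) R) : Matrix (Fin 2) (Fin 2) R) 1 0 ∈ I
    simp
  inv_mem' {g} hg := by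
    change ((g⁻¹ : GL (Fin 2) R) : Matrix (Fin 2) (Fin 2) R) 1 0 ∈ I
    rw [Matrix.coe_units_inv, Matrix.inv_def, Matrix.smul_apply, Matrix.adjugate_fin_two, smul_eq_mul]
    simp only [Matrix.of_apply, Matrix.cons_val', Matrix.cons_val_zero, Matrix.cons_val_one,
      Matrix.empty_val', Matrix.cons_val_fin_one]
    exact I.mul_mem_left _ (I.neg_mem hg)

/-- Membership in `Γ₀(I)` (definitional). [folklore] -/
@[simp]
theorem mem_gammaZeroGL_iff {I : Ideal R} {g : GL (Fin 2) R} :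
    g ∈ gammaZeroGL I ↔ (g : Matrix (Fin 2) (Fin 2) R) 1 0 ∈ I :=
  Iff.rfl

/-- `Γ₀` is monotone in the ideal. [folklore] -/
theorem gammaZeroGL_mono {I J : Ideal R} (h : I ≤ J) : gammaZeroGL I ≤ gammaZeroGL J :=
  fun _ hg => h hg

/-- `Γ₀(R) = GL₂(R)`. [folklore] -/
@[simp]
theorem gammaZeroGL_top : gammaZeroGL (⊤ : Ideal R) = ⊤ :=
  Subgroup.ext fun _ => by simp

/-! ### Elementary matrices and `Γ₀(I)` -/

/-- The matrix of the lower elementary unipotent `n⁻(x) = transvectionUnit 1 0 _ x` is Mathlib's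
`transvection 1 0 x`. [folklore] -/
theorem coe_transvectionUnit_eq_transvection {n : ℕ} (i j : Fin n) (hij : i ≠ j) (c : R) :
    ((transvectionUnit i j hij c : GL (Fin n) R) : Matrix (Fin n) (Fin n) R) = Matrix.transvection i j c :=
  rfl

/-- `n_{ij}(c) n_{ij}(d) = n_{ij}(c + d)`. [folklore] -/
theorem transvectionUnit_mul_transvectionUnit {n : ℕ} (i j : Fin n) (hij : i ≠ j) (c d : R) :
    transvectionUnit i j hij c * transvectionUnit i j hij d = transvectionUnit i j hij (c + d) :=
  Units.ext (Matrix.transvection_mul_transvection_same i j hij c d)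

/-- The lower-left entry of `n⁻(x) g` is `g₁₀ + x g₀₀`. [folklore] -/
theorem lowerTransvection_mul_apply_one_zero (x : R) (g : GL (Fin 2) R) :
    ((transvectionUnit 1 0 one_ne_zero x * g : GL (Fin 2) R) : Matrix (Fin 2) (Fin 2) R) 1 0 =
      (g : Matrix (Fin 2) (Fin 2) R) 1 0 + x * (g : Matrix (Fin 2) (Fin 2) R) 0 0 := by
  rw [Units.val_mul, coe_transvectionUnit_eq_transvection, Matrix.transvection_mul_apply_same]

/-- The upper-left entry of `n⁺(y) g` is `g₀₀ + y g₁₀`. [folklore] -/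
theorem upperTransvection_mul_apply_zero_zero (y : R) (g : GL (Fin 2) R) :
    ((transvectionUnit 0 1 zero_ne_one y * g : GL (Fin 2) R) : Matrix (Fin 2) (Fin 2) R) 0 0 =
      (g : Matrix (Fin 2) (Fin 2) R) 0 0 + y * (g : Matrix (Fin 2) (Fin 2) R) 1 0 := by
  rw [Units.val_mul, coe_transvectionUnit_eq_transvection, Matrix.transvection_mul_apply_same]

/-- The lower-left entry of `n⁺(y) g` is `g₁₀`. [folklore] -/
theorem upperTransvection_mul_apply_one_zero (y : R) (g : GL (Fin 2) R) :
    ((transvectionUnit 0 1 zero_ne_one y * g : GL (Fin 2) R) : Matrix (Fin 2) (Fin 2) R) 1 0 =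
      (g : Matrix (Fin 2) (Fin 2) R) 1 0 := by
  rw [Units.val_mul, coe_transvectionUnit_eq_transvection,
    Matrix.transvection_mul_apply_of_ne 0 1 1 0 one_ne_zero y]

/-- `n⁻(x) ∈ Γ₀(I) ↔ x ∈ I`. [folklore] -/
@[simp]
theorem lowerTransvection_mem_gammaZeroGL_iff {I : Ideal R} {x : R} :
    transvectionUnit 1 0 one_ne_zero x ∈ gammaZeroGL I ↔ x ∈ I := by
  rw [mem_gammaZeroGL_iff, coe_transvectionUnit_eq_transvection]
  simp [Matrix.transvection]

/-- `n⁺(y) ∈ Γ₀(I)` for every `y` and every `I`. [folklore] -/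
@[simp]
theorem upperTransvection_mem_gammaZeroGL (I : Ideal R) (y : R) :
    transvectionUnit 0 1 zero_ne_one y ∈ gammaZeroGL I := by
  rw [mem_gammaZeroGL_iff, coe_transvectionUnit_eq_transvection]
  simp [Matrix.transvection]

/-- Diagonal units lie in `Γ₀(I)` for every `I`. [folklore] -/
@[simp]
theorem glDiagonal_mem_gammaZeroGL (I : Ideal R) (d : Fin 2 → Rˣ) :
    glDiagonal 2 R d ∈ gammaZeroGL I := by
  rw [mem_gammaZeroGL_iff, coe_glDiagonal, Matrix.diagonal_apply_ne _ one_ne_zero]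
  exact I.zero_mem

/-- Conjugating `n⁻(x)` by the diagonal unit `diag(u, 1)`: `diag(u,1)⁻¹ n⁻(x) diag(u,1) = n⁻(x u)`.
[folklore] -/
theorem glDiagonal_inv_mul_lowerTransvection_mul_glDiagonal (u : Rˣ) (x : R) :
    (glDiagonal 2 R ![u, 1])⁻¹ * transvectionUnit 1 0 one_ne_zero x * glDiagonal 2 R ![u, 1] =
      transvectionUnit 1 0 one_ne_zero (x * u) := by
  refine Units.ext ?_
  rw [← map_inv, Units.val_mul, Units.val_mul, coe_glDiagonal, coe_glDiagonal,
    coe_transvectionUnit_eq_transvection, coe_transvectionUnit_eq_transvection]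
  ext i j
  rw [Matrix.mul_diagonal, Matrix.diagonal_mul]
  fin_cases i <;> fin_cases j <;> simp [Matrix.transvection, mul_comm]

end GammaZero

/-! ### Intermediate subgroups over a local ring with principal maximal ideal -/

section Local

variable [IsLocalRing R] {ϖ : R}

/-- In a local ring with `𝔪 = (ϖ)`: an element of `(ϖ^c)` not in `(ϖ^(c+1))` is `t ϖ^c` with `t` a
unit. [folklore] -/
theorem exists_isUnit_mul_pow_eq_of_mem_span_pow_of_not_mem
    (hϖ : IsLocalRing.maximalIdeal R = Ideal.span {ϖ}) {c : ℕ} {x : R}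
    (hx : x ∈ Ideal.span {ϖ ^ c}) (hx' : x ∉ Ideal.span {ϖ ^ (c + 1)}) :
    ∃ t : R, IsUnit t ∧ t * ϖ ^ c = x := by
  obtain ⟨t, rfl⟩ := Ideal.mem_span_singleton'.1 hx
  refine ⟨t, ?_, rfl⟩
  by_contra ht
  have htm : t ∈ Ideal.span {ϖ} := hϖ ▸ (IsLocalRing.mem_maximalIdeal _).2 ht
  obtain ⟨s, rfl⟩ := Ideal.mem_span_singleton'.1 htm
  exact hx' (Ideal.mem_span_singleton'.2 ⟨s, by ring⟩)

/-- In a local ring with `𝔪 = (ϖ)`, `ϖ` is not a unit. [folklore] -/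
theorem not_isUnit_of_maximalIdeal_eq_span (hϖ : IsLocalRing.maximalIdeal R = Ideal.span {ϖ}) :
    ¬ IsUnit ϖ := by
  have h : ϖ ∈ IsLocalRing.maximalIdeal R := hϖ ▸ Ideal.mem_span_singleton_self ϖ
  exact (IsLocalRing.mem_maximalIdeal _).1 h

/-- For an invertible `2 × 2` matrix over a local ring, if the upper-left entry is not a unit then the
lower-left entry is. [folklore] -/
theorem isUnit_apply_one_zero_of_not_isUnit_apply_zero_zero (g : GL (Fin 2) R)
    (h : ¬ IsUnit ((g : Matrix (Fin 2) (Fin 2) R) 0 0)) : IsUnit ((g : Matrix (Fin 2) (Fin 2) R) 1 0) := by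
  have hdet : IsUnit (g : Matrix (Fin 2) (Fin 2) R).det := (Matrix.isUnits_det_units g)
  rw [Matrix.det_fin_two] at hdet
  by_contra h10
  have h1 : (g : Matrix (Fin 2) (Fin 2) R) 0 0 * (g : Matrix (Fin 2) (Fin 2) R) 1 1 ∈ nonunits R :=
    mul_mem_nonunits_left h
  have h2 : -((g : Matrix (Fin 2) (Fin 2) R) 0 1 * (g : Matrix (Fin 2) (Fin 2) R) 1 0) ∈ nonunits R := by
    rw [mem_nonunits_iff, IsUnit.neg_iff, ← mem_nonunits_iff]
    exact mul_mem_nonunits_right h10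
  have := IsLocalRing.nonunits_add h1 h2
  rw [← sub_eq_add_neg] at this
  exact this hdet

variable {H : Subgroup (GL (Fin 2) R)}

omit [IsLocalRing R] in
/-- If `H ⊇ B(R) = Γ₀(⊥)` contains `h` with `h₀₀` a unit, then `n⁻(h₁₀ h₀₀⁻¹) ∈ H`
(`h = n⁻(h₁₀/h₀₀) · b` with `b` upper triangular). [folklore] -/
theorem lowerTransvection_mem_of_mem_of_isUnit (hB : gammaZeroGL (⊥ : Ideal R) ≤ H) {h : GL (Fin 2) R}
    (hh : h ∈ H) (hu : IsUnit ((h : Matrix (Fin 2) (Fin 2) R) 0 0)) :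
    transvectionUnit 1 0 one_ne_zero
      ((h : Matrix (Fin 2) (Fin 2) R) 1 0 * ↑(hu.unit⁻¹)) ∈ H := by
  set x : R := (h : Matrix (Fin 2) (Fin 2) R) 1 0 * ↑(hu.unit⁻¹) with hx
  have hb : transvectionUnit 1 0 one_ne_zero (-x) * h ∈ gammaZeroGL (⊥ : Ideal R) := by
    rw [mem_gammaZeroGL_iff, lowerTransvection_mul_apply_one_zero, Ideal.mem_bot, hx, neg_mul, mul_assoc,
      IsUnit.val_inv_mul, mul_one, add_neg_cancel]
  have hb' := hB hb
  have : transvectionUnit 1 0 one_ne_zero x =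
      h * (transvectionUnit 1 0 one_ne_zero (-x) * h)⁻¹ := by
    rw [_root_.mul_inv_rev, transvectionUnit_inv, neg_neg, mul_inv_cancel_left]
  rw [this]
  exact H.mul_mem hh (H.inv_mem hb')

omit [IsLocalRing R] in
/-- If `H ⊇ B(R)` contains `n⁻(x)`, it contains `n⁻(x u)` for every unit `u` (conjugate by
`diag(u, 1)`). [folklore] -/
theorem lowerTransvection_mul_mem_of_mem (hB : gammaZeroGL (⊥ : Ideal R) ≤ H) {x : R}
    (hx : transvectionUnit 1 0 one_ne_zero x ∈ H) (u : Rˣ) :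
    transvectionUnit 1 0 one_ne_zero (x * u) ∈ H := by
  rw [← glDiagonal_inv_mul_lowerTransvection_mul_glDiagonal u x]
  exact H.mul_mem (H.mul_mem (H.inv_mem (hB (glDiagonal_mem_gammaZeroGL _ _))) hx)
    (hB (glDiagonal_mem_gammaZeroGL _ _))

/-- KEY STEP. If `H ⊇ B(R)` contains `n⁻(ϖ^c)`, then it contains `n⁻(y)` for every `y ∈ (ϖ^c)`:
`y = s ϖ^c` with `s` a unit — conjugate — or `1 + s` a unit — `n⁻(y) = n⁻((1+s)ϖ^c) n⁻(ϖ^c)⁻¹`.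
[folklore] -/
theorem lowerTransvection_mem_of_mem_span_pow {c : ℕ} (hB : gammaZeroGL (⊥ : Ideal R) ≤ H)
    (hc : transvectionUnit 1 0 one_ne_zero (ϖ ^ c) ∈ H) {y : R} (hy : y ∈ Ideal.span {ϖ ^ c}) :
    transvectionUnit 1 0 one_ne_zero y ∈ H := by
  obtain ⟨s, rfl⟩ := Ideal.mem_span_singleton'.1 hy
  rcases IsLocalRing.isUnit_or_isUnit_one_sub_self (-s) with hs | hs
  · have := lowerTransvection_mul_mem_of_mem hB hc ((IsUnit.neg_iff _).1 hs).unit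
    rwa [IsUnit.unit_spec, mul_comm] at this
  · rw [sub_neg_eq_add] at hs
    have h1 := lowerTransvection_mul_mem_of_mem hB hc hs.unit
    rw [IsUnit.unit_spec] at h1
    have h2 : (transvectionUnit 1 0 one_ne_zero (s * ϖ ^ c) : GL (Fin 2) R) =
        transvectionUnit 1 0 one_ne_zero (ϖ ^ c * (1 + s)) * (transvectionUnit 1 0 one_ne_zero (ϖ ^ c))⁻¹ := by
      rw [transvectionUnit_inv, transvectionUnit_mul_transvectionUnit]
      congr 1
      ring
    rw [h2]
    exact H.mul_mem h1 (H.inv_mem hc)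

/-- If `H ⊇ B(R)` contains some `h` with `h₁₀ = t ϖ^c`, `t` a unit, then `n⁻(ϖ^c) ∈ H`. [folklore] -/
theorem lowerTransvection_pow_mem_of_mem (hB : gammaZeroGL (⊥ : Ideal R) ≤ H) {c : ℕ} {h : GL (Fin 2) R}
    (hh : h ∈ H) {t : R} (ht : IsUnit t) (hth : t * ϖ ^ c = (h : Matrix (Fin 2) (Fin 2) R) 1 0) :
    transvectionUnit 1 0 one_ne_zero (ϖ ^ c) ∈ H := by
  -- reduce to the case where `h₀₀` is a unit, replacing `h` by `n⁺(1) h` if necessary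
  suffices key : ∀ h' : GL (Fin 2) R, h' ∈ H → IsUnit ((h' : Matrix (Fin 2) (Fin 2) R) 0 0) →
      (h' : Matrix (Fin 2) (Fin 2) R) 1 0 = t * ϖ ^ c → transvectionUnit 1 0 one_ne_zero (ϖ ^ c) ∈ H by
    by_cases hu : IsUnit ((h : Matrix (Fin 2) (Fin 2) R) 0 0)
    · exact key h hh hu hth.symm
    · refine key (transvectionUnit 0 1 zero_ne_one 1 * h)
        (H.mul_mem (hB (upperTransvection_mem_gammaZeroGL _ _)) hh) ?_ ?_
      · rw [upperTransvection_mul_apply_zero_zero, one_mul]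
        have h10 : IsUnit ((h : Matrix (Fin 2) (Fin 2) R) 1 0) :=
          isUnit_apply_one_zero_of_not_isUnit_apply_zero_zero h hu
        by_contra hsum
        have := IsLocalRing.nonunits_add hsum (show -((h : Matrix (Fin 2) (Fin 2) R) 0 0) ∈ nonunits R by
          rwa [mem_nonunits_iff, IsUnit.neg_iff])
        rw [add_neg_cancel_comm] at this
        exact this h10
      · rw [upperTransvection_mul_apply_one_zero, hth]
  intro h' hh' hu h10
  have h1 := lowerTransvection_mem_of_mem_of_isUnit hB hh' hu
  rw [h10] at h1
  have h2 := lowerTransvection_mul_mem_of_mem hB h1 (hu.unit * ht.unit⁻¹)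
  have key : t * ϖ ^ c * ↑(hu.unit⁻¹) * ↑(hu.unit * ht.unit⁻¹) = ϖ ^ c := by
    rw [Units.val_mul]
    calc t * ϖ ^ c * ↑(hu.unit⁻¹) * (↑hu.unit * ↑(ht.unit⁻¹))
        = ϖ ^ c * (↑(hu.unit⁻¹) * ↑hu.unit) * (t * ↑(ht.unit⁻¹)) := by ring
      _ = ϖ ^ c := by rw [Units.inv_mul, IsUnit.mul_val_inv, mul_one, mul_one]
  rwa [key] at h2

/-- If `H ⊇ B(R)` contains `n⁻(y)` for every `y ∈ (ϖ^c)`, then `Γ₀(ϖ^c) ≤ H`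
(`g = n⁻(g₁₀/g₀₀) b`, after replacing `g` by `n⁺(1) g` when `g₀₀` is not a unit). [folklore] -/
theorem gammaZeroGL_span_pow_le_of_forall_lowerTransvection_mem {c : ℕ}
    (hB : gammaZeroGL (⊥ : Ideal R) ≤ H)
    (hN : ∀ y ∈ Ideal.span {ϖ ^ c}, transvectionUnit 1 0 one_ne_zero y ∈ H) :
    gammaZeroGL (Ideal.span {ϖ ^ c}) ≤ H := by
  -- the case of a unit upper-left entry
  have key : ∀ g : GL (Fin 2) R, g ∈ gammaZeroGL (Ideal.span {ϖ ^ c}) →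
      IsUnit ((g : Matrix (Fin 2) (Fin 2) R) 0 0) → g ∈ H := by
    intro g hg hu
    set x : R := (g : Matrix (Fin 2) (Fin 2) R) 1 0 * ↑(hu.unit⁻¹) with hx
    have hb : transvectionUnit 1 0 one_ne_zero (-x) * g ∈ gammaZeroGL (⊥ : Ideal R) := by
      rw [mem_gammaZeroGL_iff, lowerTransvection_mul_apply_one_zero, Ideal.mem_bot, hx, neg_mul, mul_assoc,
        IsUnit.val_inv_mul, mul_one, add_neg_cancel]
    have hxmem : x ∈ Ideal.span {ϖ ^ c} := Ideal.mul_mem_right _ _ hg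
    have : g = transvectionUnit 1 0 one_ne_zero x * (transvectionUnit 1 0 one_ne_zero (-x) * g) := by
      rw [← mul_assoc, transvectionUnit_mul_transvectionUnit, add_neg_cancel, transvectionUnit_zero, one_mul]
    rw [this]
    exact H.mul_mem (hN x hxmem) (hB hb)
  intro g hg
  by_cases hu : IsUnit ((g : Matrix (Fin 2) (Fin 2) R) 0 0)
  · exact key g hg hu
  · have h10 : IsUnit ((g : Matrix (Fin 2) (Fin 2) R) 1 0) :=
      isUnit_apply_one_zero_of_not_isUnit_apply_zero_zero g hu
    have hg' : transvectionUnit 0 1 zero_ne_one 1 * g ∈ gammaZeroGL (Ideal.span {ϖ ^ c}) := by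
      rw [mem_gammaZeroGL_iff, upperTransvection_mul_apply_one_zero]
      exact hg
    have hu' :
        IsUnit (((transvectionUnit 0 1 zero_ne_one 1 * g : GL (Fin 2) R) : Matrix (Fin 2) (Fin 2) R) 0 0) := by
      rw [upperTransvection_mul_apply_zero_zero, one_mul]
      by_contra hsum
      have := IsLocalRing.nonunits_add hsum (show -((g : Matrix (Fin 2) (Fin 2) R) 0 0) ∈ nonunits R by
        rwa [mem_nonunits_iff, IsUnit.neg_iff])
      rw [add_neg_cancel_comm] at this
      exact this h10
    have hmem := key _ hg' hu'
    have : g = (transvectionUnit 0 1 zero_ne_one (1 : R))⁻¹ * (transvectionUnit 0 1 zero_ne_one 1 * g) := by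
      rw [inv_mul_cancel_left]
    rw [this]
    exact H.mul_mem (H.inv_mem (hB (upperTransvection_mem_gammaZeroGL _ _))) hmem

/-- **The subgroups between `Γ₀(ϖ^a)` and `GL₂(R)`.**  Let `R` be a commutative local ring with
principal maximal ideal `𝔪 = (ϖ)` and `a : ℕ`.  Every subgroup `H ≤ GL₂(R)` containing
`Γ₀(ϖ^a) = {g | g₁₀ ∈ (ϖ^a)}` is `Γ₀(ϖ^c)` for some `0 ≤ c ≤ a` (so the intermediate subgroups form the
chain `Γ₀(ϖ^a) < Γ₀(ϖ^(a-1)) < ⋯ < Γ₀(1) = GL₂(R)`).  Lemma (L2) of the `bcs25` reader-1 sheet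
ADDENDUM-1 §A (the group-theoretic half of "`U₀(𝔫₀)` is a minimal level" in Manning's sense).
[folklore] -/
theorem exists_eq_gammaZeroGL_span_pow (hϖ : IsLocalRing.maximalIdeal R = Ideal.span {ϖ}) (a : ℕ)
    (hH : gammaZeroGL (Ideal.span {ϖ ^ a}) ≤ H) :
    ∃ c ≤ a, H = gammaZeroGL (Ideal.span {ϖ ^ c}) := by
  classical
  have hB : gammaZeroGL (⊥ : Ideal R) ≤ H := (gammaZeroGL_mono bot_le).trans hH
  -- `c` := the largest `k ≤ a` with `H ≤ Γ₀(ϖ^k)`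
  let P : ℕ → Prop := fun k => ∀ h ∈ H, (h : Matrix (Fin 2) (Fin 2) R) 1 0 ∈ Ideal.span {ϖ ^ k}
  have hP0 : P 0 := fun h _ => by simp [Ideal.span_singleton_one]
  set c := Nat.findGreatest P a with hc
  have hPc : P c := Nat.findGreatest_spec (P := P) (Nat.zero_le a) hP0
  have hca : c ≤ a := Nat.findGreatest_le a
  refine ⟨c, hca, le_antisymm (fun h hh => hPc h hh) ?_⟩
  -- `n⁻(ϖ^c) ∈ H`
  have hn : transvectionUnit 1 0 one_ne_zero (ϖ ^ c) ∈ H := by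
    rcases hca.eq_or_lt with hca' | hca'
    · exact hH (by rw [lowerTransvection_mem_gammaZeroGL_iff, hca']; exact Ideal.mem_span_singleton_self _)
    · have hnot : ¬ P (c + 1) := Nat.findGreatest_is_greatest (Nat.lt_succ_self c) hca'
      simp only [P, not_forall, exists_prop] at hnot
      obtain ⟨h, hh, hh'⟩ := hnot
      obtain ⟨t, ht, hth⟩ := exists_isUnit_mul_pow_eq_of_mem_span_pow_of_not_mem hϖ (hPc h hh) hh'
      exact lowerTransvection_pow_mem_of_mem hB hh ht hth
  exact gammaZeroGL_span_pow_le_of_forall_lowerTransvection_mem hB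
    (fun y hy => lowerTransvection_mem_of_mem_span_pow hB hn hy)

/-- **Maximality form** (as used for minimal levels): a subgroup of `GL₂(R)` STRICTLY containing
`Γ₀(ϖ^a)` contains `Γ₀(ϖ^c)` for some `c < a`. [folklore] -/
theorem exists_gammaZeroGL_span_pow_le_of_lt (hϖ : IsLocalRing.maximalIdeal R = Ideal.span {ϖ}) (a : ℕ)
    (hH : gammaZeroGL (Ideal.span {ϖ ^ a}) < H) :
    ∃ c < a, gammaZeroGL (Ideal.span {ϖ ^ c}) ≤ H := by
  obtain ⟨c, hca, rfl⟩ := exists_eq_gammaZeroGL_span_pow hϖ a hH.le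
  refine ⟨c, lt_of_le_of_ne hca ?_, le_rfl⟩
  rintro rfl
  exact lt_irrefl _ hH

/-- `Γ₀(ϖ^a)` is a proper subgroup of `GL₂(R)` as soon as `a ≥ 1` (the lower unipotent `n⁻(1)` is not in
it, `ϖ` being a non-unit). [folklore] -/
theorem gammaZeroGL_span_pow_ne_top (hϖ : IsLocalRing.maximalIdeal R = Ideal.span {ϖ}) {a : ℕ}
    (ha : a ≠ 0) : gammaZeroGL (Ideal.span {ϖ ^ a}) ≠ ⊤ := by
  intro h
  have h1 : transvectionUnit 1 0 one_ne_zero (1 : R) ∈ gammaZeroGL (Ideal.span {ϖ ^ a}) := h ▸ Subgroup.mem_top _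
  rw [lowerTransvection_mem_gammaZeroGL_iff, Ideal.mem_span_singleton] at h1
  exact not_isUnit_of_maximalIdeal_eq_span hϖ (isUnit_of_dvd_one (dvd_trans (dvd_pow_self ϖ ha) h1))

end Local

/-! ### The discrete valuation ring form -/

section DVR

variable [IsDomain R] [IsDiscreteValuationRing R]

/-- **The subgroups between `U₀(v^a)` and `GL₂(𝒪_v)`** for a discrete valuation ring `𝒪_v = R` with
uniformiser `ϖ`: every subgroup `H` with `U₀(v^a) ≤ H ≤ GL₂(𝒪_v)` equals `U₀(v^c)` for some
`0 ≤ c ≤ a` — verbatim lemma (L2) of `pub/bsd-litref/bcs25/sheets/D-AUDIT-bcs25-r1-ADDENDUM-1.md` §A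
(no restriction on the residue field). [folklore] -/
theorem exists_eq_gammaZeroGL_span_pow_of_irreducible {ϖ : R} (hϖ : Irreducible ϖ) (a : ℕ)
    {H : Subgroup (GL (Fin 2) R)} (hH : gammaZeroGL (Ideal.span {ϖ ^ a}) ≤ H) :
    ∃ c ≤ a, H = gammaZeroGL (Ideal.span {ϖ ^ c}) :=
  exists_eq_gammaZeroGL_span_pow hϖ.maximalIdeal_eq a hH

end DVR

end Summit.BirchSwinnertonDyer.Rank1Residual.BCS25
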